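import Mathlib
import Summits.Ventures.PercRepro2.HCov
import Summits.Ventures.PercRepro2.EdgeCubic
import Summits.Ventures.PercRepro2.KPrimePendantLemmas
import Summits.Ventures.PercRepro2.ISplit
import Summits.Ventures.PercRepro2.CovFourTerm
import Summits.Ventures.PercRepro2.FirstOrderTerms
import Summits.Ventures.PercRepro2.FirstOrderRoot
import Summits.Ventures.PercRepro2.FirstOrderPendantClosed
import Summits.Ventures.PercRepro2.FirstOrderPendant
import Summits.Ventures.PercRepro2.FirstOrderPendantClass
import Summits.Ventures.PercRepro2.FirstOrderSlope
import Summits.Ventures.PercRepro2.FirstOrderSlopeSbar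
import Summits.Ventures.PercRepro2.PendantW
import Summits.Ventures.PercRepro2.PendantCovMass
import Summits.Ventures.PercRepro2.PendantKRegime

/-!
# The dictionary `B2 = 2·T` at a pendant root edge, and the degree-one-root contraction modulo
`D(β, γ) ≥ 0` (blind cell PercRepro2, p5 g23; `proofs/P5-OEDGE.md` §29, `S4-HARDSTEP.md` v97)

Let the root `a₂` be a LEAF with its only edge `e = {a₂, z}`.  The two-copy Bernstein coefficient
`EdgeLine.B2` of `Gc` along `e` is twice the single-instance functional of §28,

  `Tcl := D·Ψ(β, γ) + Q·D₀·Ψ(σ̄_b, γ₀)` (cleared: `D·A + D·B(β) + Cc + Dmix` + `Q·D₀·A + D₀·Q·B(σ̄_b)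
  + Q·Cfo + Q·D₀·D(σ̄_b, γ₀)`, all masses of the OPEN pin = the contracted instance with root `a₂`),

evaluated at the open pin (**`B2_eq_two_Tcl`**, the recipe of `B1_eq_two_Phi`: the closed-pin masses
reduce to single-cluster scalars, the three scalars `β, D₀, D_o⁰` are flip-invariant, the open
events are world masses, `ring`).  And `Tcl` is tied to the pendant-root condition and to `(HCOV)`
of the instance by the exact identity (**`two_D0_D_Tcl`**)

  `2·D₀·D·Tcl = 2·Kc + D₀²·Gc`   (`Kc = D₀·D·(K)`, `PendantKRegime`; `Gc = D·Q·G`, `HCov.lean`),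

so `(HCOV)` at the contraction together with `(K)` — which `Kc_nonneg_of_Dmix` gives from the D-part
`Dmix = D·D(β, γ) ≥ 0` of the mixed corner — makes `B2 ≥ 0` and hence, by
`HCov_pendant_root_of_B2`, `(HCOV)` at the pendant instance at every weight of the edge:
**`HCov_pendant_root_of_Dmix`** (non-degenerate instance: `0 < D₀·D`).
-/

namespace Summit.Ventures.PercRepro2

open UnionCluster

namespace CovForm

namespace FirstOrder

section Defs

variable {V : Type*} {E : Type*} [Fintype E] [DecidableEq E] [Fintype V] [DecidableEq V]
  {R : Type*} [Field R] [LinearOrder R] [IsStrictOrderedRing R]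

/-- `S_b = E[σ_b; Q] = P(Q, b ∈ C₁) − P(Q, b ∈ C₂)`. -/
noncomputable def Sb (p : E → R) (ends : E → Sym2 V) (a₁ a₂ b : V) : R :=
  prob p (avoidAll ends a₂ {a₁} ∩ connEvent ends a₁ b) -
    prob p (avoidAll ends a₂ {a₁} ∩ connEvent ends a₂ b)

/-- **The single-instance functional `T = D·Ψ(β,γ) + Q·D₀·Ψ(σ̄_b,γ₀)` of §28, cleared**:
`D·Afo + D·Bfo + Cc + Dmix + Q·D₀·Afo + D₀·(S_b·P(PD∪T′, oH) − Q·P(PD∪T′, oH, bL)) + Q·Cfo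
+ D₀·Q·P(T, oL, bL) − D₀·S_b·P(T, oL) − Q·D_o⁰·P(T, bL) + S_b·D_o⁰·P(T)` (`Afo, Bfo, Cfo` at
`z = a₂`). -/
noncomputable def Tcl (p : E → R) (ends : E → Sym2 V) (o a₁ a₂ a₃ b : V) : R :=
  prob p (PDEvent ends a₁ a₂ a₃) * Afo p ends o a₁ a₃ b a₂ +
    prob p (PDEvent ends a₁ a₂ a₃) * Bfo p ends o a₁ a₃ b a₂ +
    FourTerm.Cc p ends o a₁ a₂ a₃ b + Dmix p ends o a₁ a₂ a₃ b +
    prob p (avoidAll ends a₂ {a₁}) * D0 p ends a₁ a₃ * Afo p ends o a₁ a₃ b a₂ +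
    D0 p ends a₁ a₃ *
      (Sb p ends a₁ a₂ b *
          (prob p (PDEvent ends a₁ a₂ a₃ ∩ connEvent ends a₂ o) +
            prob p (TEvent ends a₂ a₁ a₃ ∩ connEvent ends a₂ o)) -
        prob p (avoidAll ends a₂ {a₁}) *
          (prob p (PDEvent ends a₁ a₂ a₃ ∩ (connEvent ends a₂ o ∩ connEvent ends a₁ b)) +
            prob p (TEvent ends a₂ a₁ a₃ ∩ (connEvent ends a₂ o ∩ connEvent ends a₁ b)))) +
    prob p (avoidAll ends a₂ {a₁}) * Cfo p ends o a₁ a₃ b a₂ +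
    D0 p ends a₁ a₃ * prob p (avoidAll ends a₂ {a₁}) *
      prob p (TEvent ends a₁ a₂ a₃ ∩ (connEvent ends a₁ o ∩ connEvent ends a₁ b)) -
    D0 p ends a₁ a₃ * Sb p ends a₁ a₂ b * prob p (TEvent ends a₁ a₂ a₃ ∩ connEvent ends a₁ o) -
    prob p (avoidAll ends a₂ {a₁}) * Do0 p ends o a₁ a₃ *
      prob p (TEvent ends a₁ a₂ a₃ ∩ connEvent ends a₁ b) +
    Sb p ends a₁ a₂ b * Do0 p ends o a₁ a₃ * prob p (TEvent ends a₁ a₂ a₃)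

end Defs

section Identity

variable {V : Type*} {E : Type*} [Fintype E] [DecidableEq E] [Fintype V] [DecidableEq V]
  {R : Type*} [Field R] [LinearOrder R] [IsStrictOrderedRing R]

omit [Fintype E] [DecidableEq E] [Fintype V] [DecidableEq V] [LinearOrder R] [IsStrictOrderedRing R] in
/-- `T ∩ bL ∩ oL = T ∩ (oL ∩ bL)`. -/
lemma T_bL_oL_assoc (ends : E → Sym2 V) (o a₁ a₂ a₃ b : V) :
    TEvent ends a₁ a₂ a₃ ∩ connEvent ends a₁ b ∩ connEvent ends a₁ o =
      TEvent ends a₁ a₂ a₃ ∩ (connEvent ends a₁ o ∩ connEvent ends a₁ b) := by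
  rw [Set.inter_assoc, Set.inter_comm (connEvent ends a₁ b)]

omit [Fintype V] in
/-- **`2·D₀·D·Tcl = 2·Kc + D₀²·Gc`**: the single-instance functional is the pendant-root condition
plus half of `(HCOV)` of the instance, cleared by `D₀·D`. -/
theorem two_D0_D_Tcl (p : E → R) (ends : E → Sym2 V) (o a₁ a₂ a₃ b : V) :
    2 * D0 p ends a₁ a₃ * prob p (PDEvent ends a₁ a₂ a₃) * Tcl p ends o a₁ a₂ a₃ b =
      2 * Kc p ends o a₁ a₂ a₃ b + D0 p ends a₁ a₃ ^ 2 * Gc p ends o a₁ a₂ a₃ b := by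
  classical
  rw [FourTerm.Gc_eq_four]
  -- the `R`-masses of `Cfo`, the `(PD ⊔ T′)`-masses of `Bfo`, the `Q`-masses of `W` and `S_b`
  have hRbH := ISplit.prob_PD_add_T p ends a₁ a₂ a₃ (connEvent ends a₂ b)
  have hRbHoL' := ISplit.prob_PD_add_T p ends a₁ a₂ a₃ (connEvent ends a₁ o ∩ connEvent ends a₂ b)
  have eC2' : avoidAll ends a₁ {a₂, a₃} ∩ connEvent ends a₂ b ∩ connEvent ends a₁ o =
      avoidAll ends a₁ {a₂, a₃} ∩ (connEvent ends a₁ o ∩ connEvent ends a₂ b) := by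
    ext ω; simp only [Set.mem_inter_iff]; tauto
  have eA := Afo_event_eq ends o a₁ a₂ a₃ b
  have eB1 := ISplit.prob_PD_add_T p ends a₂ a₁ a₃ (connEvent ends a₂ o)
  have eB2 := ISplit.prob_PD_add_T p ends a₂ a₁ a₃ (connEvent ends a₂ o ∩ connEvent ends a₁ b)
  rw [PDEvent_comm] at eB1 eB2
  have eB2' : avoidAll ends a₂ {a₁, a₃} ∩ connEvent ends a₂ o ∩ connEvent ends a₁ b =
      avoidAll ends a₂ {a₁, a₃} ∩ (connEvent ends a₂ o ∩ connEvent ends a₁ b) := Set.inter_assoc _ _ _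
  have eD1 := Dfo_event_eq ends a₁ a₂ a₃ (connEvent ends a₁ b ∩ connEvent ends a₁ o)
  have eD2 := Dfo_event_eq ends a₁ a₂ a₃ (connEvent ends a₁ o)
  have eD3 := Dfo_event_eq ends a₁ a₂ a₃ (connEvent ends a₁ b)
  have eD4 := Dfo_event_eq ends a₁ a₂ a₃ Set.univ
  rw [Set.inter_univ, Set.inter_univ] at eD4
  have eD1' : avoidAll ends a₃ {a₁} ∩ connEvent ends a₃ a₂ ∩ connEvent ends a₁ b ∩ connEvent ends a₁ o =
      avoidAll ends a₃ {a₁} ∩ connEvent ends a₃ a₂ ∩ (connEvent ends a₁ b ∩ connEvent ends a₁ o) :=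
    Set.inter_assoc _ _ _
  have eD1'' : TEvent ends a₁ a₂ a₃ ∩ (connEvent ends a₁ b ∩ connEvent ends a₁ o) =
      TEvent ends a₁ a₂ a₃ ∩ (connEvent ends a₁ o ∩ connEvent ends a₁ b) := by
    rw [Set.inter_comm (connEvent ends a₁ b)]
  have eDm := T_bL_oL_assoc ends o a₁ a₂ a₃ b
  have hQbL := Qsplit p ends a₁ a₂ a₃ (connEvent ends a₁ b)
  have hQbH := Qsplit p ends a₁ a₂ a₃ (connEvent ends a₂ b)
  have hQ := Qsplit_univ p ends a₁ a₂ a₃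
  unfold Tcl Kc Wfun Phi Afo Bfo Cfo Dfo FourTerm.Cc FourTerm.Ac FourTerm.Bc FourTerm.Dc Dmix Sb
  rw [eA, eB2', ← eB1, ← eB2, eC2', ← hRbH, ← hRbHoL', eD1', eD1, eD1'', eD2, eD3, eD4, eDm,
    open_gap p ends a₁ a₂ a₃ b, hQbL, hQbH, hQ]
  delta Do
  ring

end Identity

section Dictionary

variable {V : Type*} {E : Type*} [Fintype E] [DecidableEq E] [Fintype V] [DecidableEq V]
  {R : Type*} [Field R] [LinearOrder R] [IsStrictOrderedRing R]
variable {ends : E → Sym2 V} {p : E → R} {e : E} {a₂ z : V}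

omit [Fintype V] in
/-- **The dictionary `B2 = 2·Tcl`** at a pendant root edge `e = {a₂, z}` (the only edge at `a₂`):
the two-copy Bernstein coefficient of `Gc` along `e` is twice the single-instance functional
`T = D·Ψ(β,γ) + Q·D₀·Ψ(σ̄_b,γ₀)` of the open pin (the contracted instance, root `a₂`). -/
theorem B2_eq_two_Tcl (he : p e ≠ 1) (hleaf : ∀ f, a₂ ∈ ends f → f = e)
    (hends : ends e = s(a₂, z)) {o a₁ a₃ b : V} (ho : o ≠ a₂) (h1 : a₁ ≠ a₂) (h3 : a₃ ≠ a₂)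
    (hb : b ≠ a₂) :
    EdgeLine.B2 p ends o a₁ a₂ a₃ b e = 2 * Tcl (Function.update p e 1) ends o a₁ a₂ a₃ b := by
  classical
  -- the three closed-pin scalars of `Tcl` (flip invariance at the pendant edge)
  have fβ : prob (Function.update p e 1) (connEvent ends a₁ b) =
      prob (Function.update p e 0) (connEvent ends a₁ b) :=
    KPrime.prob_update_one_eq_update_zero_of_flipInvAt he
      (KPrime.flipInvAt_connEvent hleaf hends h1 hb)
  have fD : prob (Function.update p e 1) (avoidAll ends a₁ {a₃}) =
      prob (Function.update p e 0) (avoidAll ends a₁ {a₃}) :=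
    KPrime.prob_update_one_eq_update_zero_of_flipInvAt he
      (KPrime.flipInvAt_avoidAll hleaf hends h1 (fun x hx => by
        rw [Finset.mem_singleton] at hx; rw [hx]; exact h3))
  have fDo : prob (Function.update p e 1) (avoidAll ends a₁ {a₃} ∩ connEvent ends a₁ o) =
      prob (Function.update p e 0) (avoidAll ends a₁ {a₃} ∩ connEvent ends a₁ o) :=
    KPrime.prob_update_one_eq_update_zero_of_flipInvAt he
      ((KPrime.flipInvAt_avoidAll hleaf hends h1 (fun x hx => by
        rw [Finset.mem_singleton] at hx; rw [hx]; exact h3)).inter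
        (KPrime.flipInvAt_connEvent hleaf hends h1 ho))
  -- the open-pin events of `Tcl` as world masses
  set q := Function.update p e 1 with hq
  have hRbH := ISplit.prob_PD_add_T q ends a₁ a₂ a₃ (connEvent ends a₂ b)
  have hRbHoL' := ISplit.prob_PD_add_T q ends a₁ a₂ a₃ (connEvent ends a₁ o ∩ connEvent ends a₂ b)
  have eC2' : avoidAll ends a₁ {a₂, a₃} ∩ connEvent ends a₂ b ∩ connEvent ends a₁ o =
      avoidAll ends a₁ {a₂, a₃} ∩ (connEvent ends a₁ o ∩ connEvent ends a₂ b) := by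
    ext ω; simp only [Set.mem_inter_iff]; tauto
  have eA := Afo_event_eq ends o a₁ a₂ a₃ b
  have eB1 := ISplit.prob_PD_add_T q ends a₂ a₁ a₃ (connEvent ends a₂ o)
  have eB2 := ISplit.prob_PD_add_T q ends a₂ a₁ a₃ (connEvent ends a₂ o ∩ connEvent ends a₁ b)
  rw [PDEvent_comm] at eB1 eB2
  have eB2' : avoidAll ends a₂ {a₁, a₃} ∩ connEvent ends a₂ o ∩ connEvent ends a₁ b =
      avoidAll ends a₂ {a₁, a₃} ∩ (connEvent ends a₂ o ∩ connEvent ends a₁ b) := Set.inter_assoc _ _ _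
  have eDm := T_bL_oL_assoc ends o a₁ a₂ a₃ b
  have hQbL := Qsplit q ends a₁ a₂ a₃ (connEvent ends a₁ b)
  have hQbH := Qsplit q ends a₁ a₂ a₃ (connEvent ends a₂ b)
  -- assemble
  unfold EdgeLine.B2
  rw [closed_Q hleaf h1, closed_PD hleaf h1 h3, closed_Do hleaf ho h1 h3, closed_EQbo hleaf ho h1 hb a₃,
    closed_EQb3 hleaf h1 h3 hb, closed_EQb3o hleaf ho h1 h3 hb, closed_EQo hleaf ho h1 a₃,
    closed_EQ3 hleaf h1 h3, closed_EQ3o hleaf ho h1 h3, closed_PDb hleaf h1 h3 hb,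
    closed_PDbo hleaf ho h1 h3 hb, closed_gap hleaf h1 hb a₃]
  unfold Tcl Afo Bfo Cfo FourTerm.Cc Dmix Sb beta D0 Do0
  rw [fβ, fD, fDo, eA, eB2', ← eB1, ← eB2, eC2', ← hRbH, ← hRbHoL', eDm, hQbL, hQbH,
    split_a₃ (Function.update p e 0) a₁ a₃ (connEvent ends a₁ b)]
  rw [Qsplit_univ q ends a₁ a₂ a₃, open_EQbo q ends o a₁ a₂ a₃ b, open_EQo q ends o a₁ a₂ a₃,
    open_gap q ends a₁ a₂ a₃ b]
  delta EdgeLine.B2Poly EdgeLine.polar2 EQb3 EQb3o EQ3 EQ3o PDb PDbo Do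
  ring1

end Dictionary

section Contraction

variable {V : Type*} {E : Type*} [Fintype E] [DecidableEq E] [Fintype V] [DecidableEq V]
  {R : Type*} [Field R] [LinearOrder R] [IsStrictOrderedRing R]

/-- **`(K)` is a theorem modulo the D-part of the mixed corner**: `0 ≤ Dmix → 0 ≤ Kc` on every
instance (regime `γ ≥ γ₀`: `Φ, W ≥ 0`; regime `γ ≤ γ₀`: the derivative-form identity with
`Afo, Bfo, Cc ≥ 0`, `Dmix ≥ 0`, `slopeGsbar ≥ 0`). -/
theorem Kc_nonneg_of_Dmix (p : E → R) (hp : IsProbVec p) (ends : E → Sym2 V) (o a₁ a₂ a₃ b : V)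
    (hD : 0 ≤ Dmix p ends o a₁ a₂ a₃ b) : 0 ≤ Kc p ends o a₁ a₂ a₃ b := by
  rcases le_total (Do p ends o a₁ a₂ a₃ * D0 p ends a₁ a₃)
      (prob p (PDEvent ends a₁ a₂ a₃) * Do0 p ends o a₁ a₃) with h | h
  · rw [Kc_eq_four]
    have hA := Afo_nonneg p hp ends o a₁ a₃ b a₂
    have hB := Bfo_nonneg p hp ends o a₁ a₃ b a₂
    have hC := FourTerm.Cc_nonneg p hp ends o a₁ a₂ a₃ b
    have hS := slopeGsbar_nonneg p hp ends a₁ a₂ a₃ b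
    have h0 : 0 ≤ D0 p ends a₁ a₃ := prob_nonneg hp _
    have hPD : 0 ≤ prob p (PDEvent ends a₁ a₂ a₃) := prob_nonneg hp _
    have hfour : 0 ≤ prob p (PDEvent ends a₁ a₂ a₃) * Afo p ends o a₁ a₃ b a₂ +
        prob p (PDEvent ends a₁ a₂ a₃) * Bfo p ends o a₁ a₃ b a₂ +
        FourTerm.Cc p ends o a₁ a₂ a₃ b + Dmix p ends o a₁ a₂ a₃ b := by
      have := mul_nonneg hPD hA
      have := mul_nonneg hPD hB
      linarith
    have h1 : 0 ≤ D0 p ends a₁ a₃ * prob p (PDEvent ends a₁ a₂ a₃) *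
        (prob p (PDEvent ends a₁ a₂ a₃) * Afo p ends o a₁ a₃ b a₂ +
          prob p (PDEvent ends a₁ a₂ a₃) * Bfo p ends o a₁ a₃ b a₂ +
          FourTerm.Cc p ends o a₁ a₂ a₃ b + Dmix p ends o a₁ a₂ a₃ b) :=
      mul_nonneg (mul_nonneg h0 hPD) hfour
    have h2 : D0 p ends a₁ a₃ * (Do p ends o a₁ a₂ a₃ * D0 p ends a₁ a₃ -
        prob p (PDEvent ends a₁ a₂ a₃) * Do0 p ends o a₁ a₃) * slopeGsbar p ends a₁ a₂ a₃ b ≤ 0 := by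
      have hneg : Do p ends o a₁ a₂ a₃ * D0 p ends a₁ a₃ -
          prob p (PDEvent ends a₁ a₂ a₃) * Do0 p ends o a₁ a₃ ≤ 0 := by linarith
      have := mul_nonpos_of_nonneg_of_nonpos h0 hneg
      exact mul_nonpos_of_nonpos_of_nonneg this hS
    linarith
  · exact Kc_nonneg_of_hi p hp ends o a₁ a₂ a₃ b h

variable {ends : E → Sym2 V} {p : E → R} {e : E} {a₂ z : V}

/-- **THE DEGREE-ONE-ROOT CONTRACTION MODULO `D(β,γ) ≥ 0`**: at a pendant root edge `e = {a₂, z}`,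
`(HCOV)` at the contraction (the open pin) and the D-part `Dmix ≥ 0` of the mixed corner of the
contracted instance give `(HCOV)` at the pendant instance at every weight of the edge
(non-degenerate contracted instance: `0 < D₀·D`). -/
theorem HCov_pendant_root_of_Dmix (hp : IsProbVec p) (he : p e ≠ 1)
    (hleaf : ∀ f, a₂ ∈ ends f → f = e) (hends : ends e = s(a₂, z)) {o a₁ a₃ b : V} (ho : o ≠ a₂)
    (h1 : a₁ ≠ a₂) (h3 : a₃ ≠ a₂) (hb : b ≠ a₂)
    (h₁ : HCov (Function.update p e 1) ends o a₁ a₂ a₃ b)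
    (hD : 0 ≤ Dmix (Function.update p e 1) ends o a₁ a₂ a₃ b)
    (hpos : 0 < D0 (Function.update p e 1) ends a₁ a₃ *
      prob (Function.update p e 1) (PDEvent ends a₁ a₂ a₃)) :
    HCov p ends o a₁ a₂ a₃ b := by
  have hp₁ : IsProbVec (Function.update p e 1) := hp.update e zero_le_one le_rfl
  have hK := Kc_nonneg_of_Dmix (Function.update p e 1) hp₁ ends o a₁ a₂ a₃ b hD
  have hG : 0 ≤ Gc (Function.update p e 1) ends o a₁ a₂ a₃ b := h₁
  have hid := two_D0_D_Tcl (Function.update p e 1) ends o a₁ a₂ a₃ b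
  have hT : 0 ≤ Tcl (Function.update p e 1) ends o a₁ a₂ a₃ b := by
    have h0 : 0 ≤ D0 (Function.update p e 1) ends a₁ a₃ ^ 2 := sq_nonneg _
    have hprod : 0 ≤ 2 * D0 (Function.update p e 1) ends a₁ a₃ *
        prob (Function.update p e 1) (PDEvent ends a₁ a₂ a₃) * Tcl (Function.update p e 1) ends o a₁ a₂ a₃ b := by
      rw [hid]; nlinarith [mul_nonneg h0 hG]
    have h2pos : 0 < 2 * D0 (Function.update p e 1) ends a₁ a₃ *
        prob (Function.update p e 1) (PDEvent ends a₁ a₂ a₃) := by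
      rw [mul_assoc]; exact mul_pos two_pos hpos
    exact nonneg_of_mul_nonneg_right hprod h2pos
  apply HCov_pendant_root_of_B2 hp he hleaf hends ho h1 h3 hb h₁
  rw [B2_eq_two_Tcl he hleaf hends ho h1 h3 hb]
  linarith

end Contraction

end FirstOrder

end CovForm

end Summit.Ventures.PercRepro2
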